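import Mathlib
import Summits.ResolutionOfSingularities.ResolutionOfSingularities.Theorems.HomologicalConductorPersistenceSurfaceNormalPartition
import Summits.ResolutionOfSingularities.ResolutionOfSingularities.Theorems.HomologicalConductorPersistenceFaithfullyFlatDescentCompletion
import Summits.ResolutionOfSingularities.ResolutionOfSingularities.Theorems.HomologicalConductorNoZenoIffKernel
import Summits.ResolutionOfSingularities.ResolutionOfSingularities.Theorems.HomologicalConductorNoZenoTowerNoetherian
import Summits.ResolutionOfSingularities.ResolutionOfSingularities.Theorems.HomologicalConductorPersistenceSurfaceSaturationResidualTwo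
import HarnessLib

/-!
# Rung S-2 `PersistenceSurface` (stmt-ResolutionOfSingularities-19970) — ORDER w44b-o12′:
# the typed conjecture CSP″ «COMPLETED STEP PERSISTENCE» on the normal-rational class, its glue to
# `LevelFourPersistenceRationalNormal`, and the S-2 door of record

Route `ResolutionOfSingularities/HomologicalConductor`, chain W4.4b (cell `res-hironaka`, LADDER-RESOLUTION
rung L), rung S-2 `PersistenceSurface` (stmt-ResolutionOfSingularities-19970), door L₄R♮. OURS; nothing here
is a statement of the manuscript under review (Hironaka 2017) and no statement of that manuscript is used;
AI-written, weaker than expert review. Filed `--supports stmt-ResolutionOfSingularities-19970 --as helper` by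
res-type-010 on res-L1-w44b-plan-1's RE-POINT (2026-08-27T09:32:34Z; CHAIN w44b v12 §V12 o12′; sketch
`L/w44b/Sketch-o12.lean` sha16 `ad70a0013a90a5d1`, typed verbatim below with the decl names of record).

After res-L1-w44b-tri-1's corrections E-12/E-13 (DC-CUSTODY v2.1 §8: the dual-cover route (DC)/(DC′)
leaves the critical path; (VAL) is a theorem on the reduced-`Z_f` rational class) the door L₄R♮ is
RE-FOUNDED ON COMPLETED PERSISTENCE:

* `CompletedStepPersistenceRationalNormal` — CONJECTURE CSP″ [OURS]: binders VERBATIM those of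
  `LevelFourPersistenceRationalNormal` (`…PersistenceSurfaceNormalPartition`, p509308 lineage: the surface
  datum `(A, O)`, the stage-0 hypothesis «normal with a rational singularity, or regular», `ringKrullDim A ≤ 2`),
  conclusion PER STEP `T_m → T_(m+1)` of the canonical normalised `ca`-tower (`NoZeno.Birth.tower O A`):
  every `x ∈ ca⁴(T_m)` is mapped into `ca⁴(T̂_(m+1))`, `T̂_(m+1) := AdicCompletion 𝔪 T_(m+1)` — the step
  inclusion COMPLETED AT THE TARGET. Memo-level proof on the reduced-`Z_f` rational class: BHST 4.5 (2)
  ascent (U2) + the chart formula (1.1) `ca⁴(T̂) = I_𝓛` + (VAL) (tri-1 DC-CUSTODY v2.1 §8.6) + (Rec);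
  the case `z ≥ 2` is open (Q-VALMULT). Typed as a Prop, consumed only as a hypothesis;
* `levelFourPersistenceRationalNormal_of_completedStep` — GLUE, PROVED:
  `CompletedStepPersistenceRationalNormal → LevelFourPersistenceRationalNormal`, by the PROVED descent
  `caCompletion_comap_le_holds` (BHST 4.5 (1), p512917, `…FaithfullyFlatDescentCompletion`) at
  `T' := T_(m+1)`: `ca⁴(T̂_(m+1)) ∩ T_(m+1) ⊆ ca⁴(T_(m+1))`; the stage instances come from
  `stub_towerNoetherian` (p-lineage `…NoZenoTowerNoetherian`) and `exists_tower_eq_loc` / `loc_eq_locAt` /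
  `SyzygyFlattening.isLocalRing_locAt`;
* `persistenceSurface_of_residual₂_of_completedStep_of_rest` — **THE S-2 DOOR OF RECORD (CHAIN v12)**:
  `SaturationFourSurfaceResidual₂ → CompletedStepPersistenceRationalNormal →
   LevelFourPersistenceNonnormalOrNonrational → PersistenceSurface`, composing res-type-011's
  `persistenceSurface_of_residual₂_of_levelFour` (p515999) with
  `levelFourPersistenceSurface_of_rationalNormal_of_rest` (o6b) and the glue above. The rung thus stands
  MODULO exactly {`SaturationFourSurfaceResidual₂` (→ Residual₃, res-type-011), CSP″ [OURS conjecture],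
  `LevelFourPersistenceNonnormalOrNonrational` (Σ6 ∪ Σ8 class)} — each a typed Prop carried as a hypothesis.

References: res-L1-w44b-plan-1 CHAIN w44b v12 (o12′), res-L1-w44b-tri-1 DC-CUSTODY v2.1 §8 (OURS); A. Bahlekeh,
E. Hakimian, S. Salarian, R. Takahashi, *Annihilation of cohomology, generation of modules and finiteness of
derived dimension*, Q. J. Math. 67 (2016) [BahlekehHakimianSalarianTakahashi2015, Thm. 4.5] — context for the
ascent/descent facts cited by name.
-/

set_option linter.dupNamespace false -- mandated namespace `Summit.<Summit>.<Problem>` of this single-conjunct summit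

noncomputable section

namespace Summit.ResolutionOfSingularities.ResolutionOfSingularities.Theorems.HomologicalConductor.PersistenceSurfaceCompletedStep

open Literature.RingTheory.CohomologyAnnihilator
open Summit.ResolutionOfSingularities.ResolutionOfSingularities.Theorems.NoZeno.Birth
open Summit.ResolutionOfSingularities.ResolutionOfSingularities.Theorems.HomologicalConductor.PersistenceSurfaceLevelFour
open Summit.ResolutionOfSingularities.ResolutionOfSingularities.Theorems.HomologicalConductor.PersistenceSurfaceRational
open Summit.ResolutionOfSingularities.ResolutionOfSingularities.Theorems.HomologicalConductor.PersistenceSurfaceRationalAssembly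
open Summit.ResolutionOfSingularities.ResolutionOfSingularities.Theorems.HomologicalConductor.PersistenceSurfaceNormalPartition
open Summit.ResolutionOfSingularities.ResolutionOfSingularities.Theorems.HomologicalConductor.PersistenceFaithfullyFlatDescentCompletion
open Summit.ResolutionOfSingularities.ResolutionOfSingularities.Theorems.HomologicalConductor.PersistenceSurfaceSaturationResidualTwo

/-! ## The typed conjecture CSP″ -/

/-- **CONJECTURE CSP″ `CompletedStepPersistenceRationalNormal` [OURS · L1 w44b · CHAIN v12 o12′] — COMPLETED
STEP PERSISTENCE on the class (R♮):** along the canonical normalised `ca`-tower of a surface datum `(A, O)`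
whose stage `0` is normal with a rational singularity or regular (binders VERBATIM those of
`LevelFourPersistenceRationalNormal`), for every step `T_m → T_(m+1)` and every `x ∈ ca⁴(T_m)`, the image
of `x` in the `𝔪`-adic completion `T̂_(m+1)` lies in `ca⁴(T̂_(m+1))`. Memo-level proof on the reduced-`Z_f`
rational class: BHST 4.5 (2) ascent + (1.1) `ca⁴(T̂) = I_𝓛` + (VAL) (res-L1-w44b-tri-1 DC-CUSTODY v2.1 §8.6,
a theorem) + (Rec); the case `z ≥ 2` is open (Q-VALMULT). A typed Prop consumed only as a hypothesis; NOT a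
statement of the manuscript under review. -/
@[conjecture]
def CompletedStepPersistenceRationalNormal : Prop :=
  ∀ p : ℕ, p.Prime → ∀ (k K : Type) [Field k] [CharP k p] [Field K] [Algebra k K]
    (O : ValuationSubring K) (A : Subalgebra k K), (∀ c : k, algebraMap k K c ∈ O) → A.FG →
    IsFractionRing ↥A K → A.toSubring ≤ O.toSubring → ringKrullDim ↥A ≤ 2 →
    ((IsIntegrallyClosed ↥(tower O A 0) ∧
        Literature.AlgebraicGeometry.Resolution.HasRationalSingularity ↥(tower O A 0)) ∨
      IsRegularLocalRing ↥(tower O A 0)) →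
    ∀ (m : ℕ) (hle : tower O A m ≤ tower O A (m + 1))
      [IsNoetherianRing ↥(tower O A (m + 1))] [IsLocalRing ↥(tower O A (m + 1))]
      (x : ↥(tower O A m)), x ∈ cohomologyAnnihilatorOfDegree ↥(tower O A m) 4 →
      algebraMap ↥(tower O A (m + 1))
          (AdicCompletion (IsLocalRing.maximalIdeal ↥(tower O A (m + 1))) ↥(tower O A (m + 1)))
          (Subalgebra.inclusion hle x) ∈
        cohomologyAnnihilatorOfDegree
          (AdicCompletion (IsLocalRing.maximalIdeal ↥(tower O A (m + 1))) ↥(tower O A (m + 1))) 4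

/-! ## The glue to `LevelFourPersistenceRationalNormal` -/

/-- **GLUE [OURS · o12′], PROVED: CSP″ ⇒ `LevelFourPersistenceRationalNormal`**, by the PROVED descent
`caCompletion_comap_le_holds` (BHST 4.5 (1), p512917) at `T' := T_(m+1)`: membership in `ca⁴(T̂_(m+1))`
pulls back to `ca⁴(T_(m+1))` along `T_(m+1) → T̂_(m+1)`; the noetherian / local instances of the stage come
from `stub_towerNoetherian` and `exists_tower_eq_loc` / `loc_eq_locAt` / `SyzygyFlattening.isLocalRing_locAt`.
[folklore] -/
theorem levelFourPersistenceRationalNormal_of_completedStep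
    (hC : CompletedStepPersistenceRationalNormal) : LevelFourPersistenceRationalNormal := by
  intro p hp k K _ _ _ _ O A hk hA hfr hAO hdim caAt ca loc chart nrm tower' hRN m x hx
  obtain ⟨hxT, hx4⟩ := hx
  have hle : tower O A m ≤ tower O A (m + 1) := fun y hy => by
    rw [tower_succ]
    exact SyzygyFlattening.self_le_locAt O _
      (SyzygyFlattening.self_le_nrm _ (Algebra.subset_adjoin (Or.inl hy)))
  haveI : IsNoetherianRing ↥(tower O A (m + 1)) := stub_towerNoetherian k K O A hk hA hfr hAO _
  haveI : IsLocalRing ↥(tower O A (m + 1)) := by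
    obtain ⟨B, hBO, hTB⟩ := exists_tower_eq_loc O A hk hAO (m + 1)
    rw [hTB, loc_eq_locAt]; exact SyzygyFlattening.isLocalRing_locAt O B hBO
  have hx' : (⟨x, hxT⟩ : ↥(tower O A m)) ∈ cohomologyAnnihilatorOfDegree ↥(tower O A m) 4 :=
    mem_cohomologyAnnihilatorOfDegree_iff.mpr hx4
  have hmem := hC p hp k K O A hk hA hfr hAO hdim hRN m hle ⟨x, hxT⟩ hx'
  have hdesc := hdesc_completion caCompletion_comap_le_holds.{0} (T' := ↥(tower O A (m + 1)))
  have hx'' : Subalgebra.inclusion hle ⟨x, hxT⟩ ∈ cohomologyAnnihilatorOfDegree ↥(tower O A (m + 1)) 4 :=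
    hdesc (Ideal.mem_comap.mpr hmem)
  exact ⟨hle hxT, mem_cohomologyAnnihilatorOfDegree_iff.mp hx''⟩

/-! ## The S-2 door of record (CHAIN w44b v12) -/

/-- **THE S-2 DOOR OF RECORD [OURS · L1 w44b · CHAIN v12]:** the rung `PersistenceSurface` follows from the
second saturation residual (res-type-011, p515999), the completed-step conjecture CSP″ on the normal-rational
class, and level-four persistence on the complementary class (Σ6 ∪ Σ8) — composing
`persistenceSurface_of_residual₂_of_levelFour` with `levelFourPersistenceSurface_of_rationalNormal_of_rest`
and `levelFourPersistenceRationalNormal_of_completedStep`. Every premise is a typed Prop [OURS] carried as a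
hypothesis; nothing is asserted. [folklore] -/
theorem persistenceSurface_of_residual₂_of_completedStep_of_rest
    (hS : SaturationFourSurfaceResidual₂) (hC : CompletedStepPersistenceRationalNormal)
    (hN : LevelFourPersistenceNonnormalOrNonrational) :
    Summit.ResolutionOfSingularities.ResolutionOfSingularities.Theses.HomologicalConductor.PersistenceSurface :=
  persistenceSurface_of_residual₂_of_levelFour hS
    (levelFourPersistenceSurface_of_rationalNormal_of_rest
      (levelFourPersistenceRationalNormal_of_completedStep hC) hN)

end Summit.ResolutionOfSingularities.ResolutionOfSingularities.Theorems.HomologicalConductor.PersistenceSurfaceCompletedStep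

end
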